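import Mathlib.Analysis.SpecialFunctions.Pow.Real
import Mathlib.Algebra.Order.Field.GeomSum
import Mathlib.Algebra.BigOperators.Intervals

/-!
# Weighted geometric sums of a discrete dichotomy and the weighted-maximum argument

Topic `Literature/Dynamics/Hyperbolic`.  The pure real-inequality bookkeeping behind two-sided exponential
estimates for discrete dichotomies (shadowing / tracking near hyperbolic sets, Pilyugin1999 §1.3): for
`0 ≤ λ < θ < 1` and the two-sided weights `b_j = θ^j α + θ^{n-j} β`,

* `Σ_{j<k} λ^{k-1-j} b_j + Σ_{k≤j<n} λ^{j+1-k} b_j ≤ K b_k`, `K = 1/(θ-λ) + 1/(1-λθ)` (`weighted_sums_le`, from the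
  four one-sided geometric bounds `sum_range_pow_mul_pow_le`, `sum_range_pow_mul_pow_sub_le`,
  `sum_Ico_pow_mul_pow_le`, `sum_Ico_pow_mul_pow_sub_le`, each proved by the forward/backward recursions
  `sum_range_succ_pow_sub`, `sum_Ico_pow_sub_eq`);
* the WEIGHTED-MAXIMUM ARGUMENT `two_sided_bound_of_ineq`: a non-negative finite sequence with
  `a_k ≤ Nλ^k a_0 + Nλ^{n-k} a_n + Nc(Σ_{j<k} λ^{k-1-j} a_j + Σ_{k≤j<n} λ^{j+1-k} a_j)` and `NcK ≤ 1/2` satisfies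
  `a_k ≤ 2N(θ^k a_0 + θ^{n-k} a_n)`.

No dynamics here; consumed by `HyperbolicTracking.lean`.  [folklore]
References: S. Yu. Pilyugin, *Shadowing in Dynamical Systems*, LNM 1706 (1999), §1.3 [Pilyugin1999].
-/

noncomputable section

open Set Function

namespace Literature.Dynamics.Hyperbolic

/-! ## Geometric-series bookkeeping (pure real inequalities) -/

section Geometric

open Finset

variable {lam θ : ℝ}

/-- Forward recursion of the weighted sums: `Σ_{j<k+1} λ^{k-j} c_j = λ Σ_{j<k} λ^{k-1-j} c_j + c_k`. [folklore] -/
theorem sum_range_succ_pow_sub (lam : ℝ) (c : ℕ → ℝ) (k : ℕ) :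
    ∑ j ∈ range (k + 1), lam ^ (k + 1 - 1 - j) * c j =
      lam * ∑ j ∈ range k, lam ^ (k - 1 - j) * c j + c k := by
  rw [Finset.sum_range_succ, Finset.mul_sum]
  simp only [Nat.add_sub_cancel, Nat.sub_self, pow_zero, one_mul, add_left_inj]
  refine Finset.sum_congr rfl fun j hj => ?_
  have hjk : j < k := Finset.mem_range.1 hj
  have : k - j = (k - 1 - j) + 1 := by omega
  rw [this, pow_succ]
  ring

/-- Backward recursion: for `k < n`,
`Σ_{k≤j<n} λ^{j+1-k} c_j = λ (c_k + Σ_{k+1≤j<n} λ^{j+1-(k+1)} c_j)`. [folklore] -/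
theorem sum_Ico_pow_sub_eq (lam : ℝ) (c : ℕ → ℝ) {k n : ℕ} (hkn : k < n) :
    ∑ j ∈ Ico k n, lam ^ (j + 1 - k) * c j =
      lam * (c k + ∑ j ∈ Ico (k + 1) n, lam ^ (j + 1 - (k + 1)) * c j) := by
  rw [Finset.sum_eq_sum_Ico_succ_bot hkn, mul_add, Finset.mul_sum]
  simp only [Nat.add_sub_cancel_left, pow_one, add_right_inj]
  refine Finset.sum_congr rfl fun j hj => ?_
  have hjk : k + 1 ≤ j := (Finset.mem_Ico.1 hj).1
  have : j + 1 - k = (j + 1 - (k + 1)) + 1 := by omega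
  rw [this, pow_succ]
  ring

/-- `Σ_{j<k} λ^{k-1-j} θ^j ≤ θ^k/(θ - λ)` for `0 ≤ λ < θ`. [folklore] -/
theorem sum_range_pow_mul_pow_le (h0 : 0 ≤ lam) (hθ : lam < θ) (k : ℕ) :
    ∑ j ∈ range k, lam ^ (k - 1 - j) * θ ^ j ≤ θ ^ k / (θ - lam) := by
  have hd : 0 < θ - lam := sub_pos.2 hθ
  induction k with
  | zero => simp only [Finset.range_zero, Finset.sum_empty, pow_zero]; positivity
  | succ k ih =>
    rw [sum_range_succ_pow_sub lam (fun j => θ ^ j) k]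
    calc lam * ∑ j ∈ range k, lam ^ (k - 1 - j) * θ ^ j + θ ^ k
        ≤ lam * (θ ^ k / (θ - lam)) + θ ^ k := by gcongr
      _ = θ ^ (k + 1) / (θ - lam) := by
          field_simp
          ring

/-- `Σ_{j<k} λ^{k-1-j} θ^{n-j} ≤ θ^{n-k}/(1 - λθ)` for `k ≤ n`, `0 ≤ λ`, `0 ≤ θ ≤ 1`, `λθ < 1`. [folklore] -/
theorem sum_range_pow_mul_pow_sub_le (h0 : 0 ≤ lam) (hθ0 : 0 ≤ θ) (hθ1 : θ ≤ 1) (hlt : lam * θ < 1)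
    {k n : ℕ} (hkn : k ≤ n) :
    ∑ j ∈ range k, lam ^ (k - 1 - j) * θ ^ (n - j) ≤ θ ^ (n - k) / (1 - lam * θ) := by
  have hd : 0 < 1 - lam * θ := sub_pos.2 hlt
  induction k with
  | zero => simp only [Finset.range_zero, Finset.sum_empty, Nat.sub_zero]; positivity
  | succ k ih =>
    have hk : k ≤ n := (Nat.le_succ k).trans hkn
    rw [sum_range_succ_pow_sub lam (fun j => θ ^ (n - j)) k]
    have e : θ ^ (n - k) = θ * θ ^ (n - (k + 1)) := by
      rw [← pow_succ']; congr 1; omega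
    have hp : 0 ≤ θ ^ (n - (k + 1)) := pow_nonneg hθ0 _
    have key : θ * (lam + (1 - lam * θ)) ≤ 1 := by nlinarith [mul_nonneg h0 hθ0]
    calc lam * ∑ j ∈ range k, lam ^ (k - 1 - j) * θ ^ (n - j) + θ ^ (n - k)
        ≤ lam * (θ ^ (n - k) / (1 - lam * θ)) + θ ^ (n - k) := by gcongr; exact ih hk
      _ = θ ^ (n - (k + 1)) * (θ * (lam + (1 - lam * θ)) / (1 - lam * θ)) := by
          rw [e]; field_simp
      _ ≤ θ ^ (n - (k + 1)) * (1 / (1 - lam * θ)) := by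
          gcongr
      _ = θ ^ (n - (k + 1)) / (1 - lam * θ) := by ring

/-- `Σ_{k≤j<n} λ^{j+1-k} θ^j ≤ λθ^k/(1 - λθ)` for `k ≤ n`, `0 ≤ λ`, `0 ≤ θ`, `λθ < 1`. [folklore] -/
theorem sum_Ico_pow_mul_pow_le (h0 : 0 ≤ lam) (hθ0 : 0 ≤ θ) (hlt : lam * θ < 1) {k n : ℕ} (hkn : k ≤ n) :
    ∑ j ∈ Ico k n, lam ^ (j + 1 - k) * θ ^ j ≤ lam * θ ^ k / (1 - lam * θ) := by
  have hd : 0 < 1 - lam * θ := sub_pos.2 hlt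
  suffices H : ∀ i k : ℕ, k + i = n →
      ∑ j ∈ Ico k n, lam ^ (j + 1 - k) * θ ^ j ≤ lam * θ ^ k / (1 - lam * θ) from H (n - k) k (by omega)
  intro i
  induction i with
  | zero =>
    intro k hk
    rw [add_zero] at hk
    subst hk
    simp only [Finset.Ico_self, Finset.sum_empty]
    positivity
  | succ i ih =>
    intro k hk
    have hkn : k < n := by omega
    rw [sum_Ico_pow_sub_eq lam (fun j => θ ^ j) hkn]
    have ih' := ih (k + 1) (by omega)
    calc lam * (θ ^ k + ∑ j ∈ Ico (k + 1) n, lam ^ (j + 1 - (k + 1)) * θ ^ j)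
        ≤ lam * (θ ^ k + lam * θ ^ (k + 1) / (1 - lam * θ)) := by gcongr
      _ = lam * θ ^ k / (1 - lam * θ) := by rw [pow_succ]; field_simp; ring

/-- `Σ_{k≤j<n} λ^{j+1-k} θ^{n-j} ≤ θ^{n-k} λθ/(θ - λ)` for `k ≤ n`, `0 ≤ λ < θ`. [folklore] -/
theorem sum_Ico_pow_mul_pow_sub_le (h0 : 0 ≤ lam) (hθ : lam < θ) {k n : ℕ} (hkn : k ≤ n) :
    ∑ j ∈ Ico k n, lam ^ (j + 1 - k) * θ ^ (n - j) ≤ θ ^ (n - k) * (lam * θ / (θ - lam)) := by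
  have hd : 0 < θ - lam := sub_pos.2 hθ
  have hθ0 : 0 ≤ θ := h0.trans hθ.le
  suffices H : ∀ i k : ℕ, k + i = n →
      ∑ j ∈ Ico k n, lam ^ (j + 1 - k) * θ ^ (n - j) ≤ θ ^ (n - k) * (lam * θ / (θ - lam)) from
    H (n - k) k (by omega)
  intro i
  induction i with
  | zero =>
    intro k hk
    rw [add_zero] at hk
    subst hk
    simp only [Finset.Ico_self, Finset.sum_empty]
    positivity
  | succ i ih =>
    intro k hk
    have hkn : k < n := by omega
    rw [sum_Ico_pow_sub_eq lam (fun j => θ ^ (n - j)) hkn]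
    have ih' := ih (k + 1) (by omega)
    have e : θ ^ (n - k) = θ * θ ^ (n - (k + 1)) := by
      rw [← pow_succ']; congr 1; omega
    calc lam * (θ ^ (n - k) + ∑ j ∈ Ico (k + 1) n, lam ^ (j + 1 - (k + 1)) * θ ^ (n - j))
        ≤ lam * (θ ^ (n - k) + θ ^ (n - (k + 1)) * (lam * θ / (θ - lam))) := by gcongr
      _ = θ ^ (n - k) * (lam * θ / (θ - lam)) := by rw [e]; field_simp; ring

/-- The combined weighted-sum inequality for the two-sided weights `b_j = θ^j α + θ^{n-j} β` (`α, β ≥ 0`):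
`Σ_{j<k} λ^{k-1-j} b_j + Σ_{k≤j<n} λ^{j+1-k} b_j ≤ K b_k` with `K = 1/(θ-λ) + 1/(1-λθ)`, for
`0 ≤ λ < θ < 1`, `k ≤ n`. [folklore] -/
theorem weighted_sums_le (h0 : 0 ≤ lam) (hθ : lam < θ) (hθ1 : θ < 1) {α β : ℝ} (hα : 0 ≤ α)
    (hβ : 0 ≤ β) {k n : ℕ} (hkn : k ≤ n) :
    ∑ j ∈ range k, lam ^ (k - 1 - j) * (θ ^ j * α + θ ^ (n - j) * β) +
        ∑ j ∈ Ico k n, lam ^ (j + 1 - k) * (θ ^ j * α + θ ^ (n - j) * β) ≤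
      (1 / (θ - lam) + 1 / (1 - lam * θ)) * (θ ^ k * α + θ ^ (n - k) * β) := by
  have hθ0 : 0 ≤ θ := h0.trans hθ.le
  have hlam1 : lam < 1 := hθ.trans hθ1
  have hlt : lam * θ < 1 := by nlinarith
  have hd1 : 0 < θ - lam := sub_pos.2 hθ
  have hd2 : 0 < 1 - lam * θ := sub_pos.2 hlt
  have h1 := sum_range_pow_mul_pow_le h0 hθ k
  have h2 := sum_range_pow_mul_pow_sub_le h0 hθ0 hθ1.le hlt hkn
  have h3 := sum_Ico_pow_mul_pow_le h0 hθ0 hlt hkn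
  have h4 := sum_Ico_pow_mul_pow_sub_le h0 hθ hkn
  -- split the sums
  have eq1 : ∑ j ∈ range k, lam ^ (k - 1 - j) * (θ ^ j * α + θ ^ (n - j) * β) =
      α * ∑ j ∈ range k, lam ^ (k - 1 - j) * θ ^ j +
        β * ∑ j ∈ range k, lam ^ (k - 1 - j) * θ ^ (n - j) := by
    rw [Finset.mul_sum, Finset.mul_sum, ← Finset.sum_add_distrib]
    refine Finset.sum_congr rfl fun j _ => ?_; ring
  have eq2 : ∑ j ∈ Ico k n, lam ^ (j + 1 - k) * (θ ^ j * α + θ ^ (n - j) * β) =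
      α * ∑ j ∈ Ico k n, lam ^ (j + 1 - k) * θ ^ j +
        β * ∑ j ∈ Ico k n, lam ^ (j + 1 - k) * θ ^ (n - j) := by
    rw [Finset.mul_sum, Finset.mul_sum, ← Finset.sum_add_distrib]
    refine Finset.sum_congr rfl fun j _ => ?_; ring
  rw [eq1, eq2]
  -- bounds on the four coefficients
  have c3 : lam * θ ^ k / (1 - lam * θ) ≤ θ ^ k / (1 - lam * θ) := by
    apply div_le_div_of_nonneg_right _ hd2.le
    nlinarith [pow_nonneg hθ0 k]
  have c4 : θ ^ (n - k) * (lam * θ / (θ - lam)) ≤ θ ^ (n - k) / (θ - lam) := by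
    rw [← mul_one_div (θ ^ (n - k)) (θ - lam)]
    apply mul_le_mul_of_nonneg_left _ (pow_nonneg hθ0 _)
    exact div_le_div_of_nonneg_right hlt.le hd1.le
  have hθk : 0 ≤ θ ^ k := pow_nonneg hθ0 k
  have hθnk : 0 ≤ θ ^ (n - k) := pow_nonneg hθ0 _
  calc α * ∑ j ∈ range k, lam ^ (k - 1 - j) * θ ^ j +
          β * ∑ j ∈ range k, lam ^ (k - 1 - j) * θ ^ (n - j) +
        (α * ∑ j ∈ Ico k n, lam ^ (j + 1 - k) * θ ^ j +
          β * ∑ j ∈ Ico k n, lam ^ (j + 1 - k) * θ ^ (n - j))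
      ≤ α * (θ ^ k / (θ - lam)) + β * (θ ^ (n - k) / (1 - lam * θ)) +
        (α * (θ ^ k / (1 - lam * θ)) + β * (θ ^ (n - k) / (θ - lam))) := by
        gcongr
        · exact h3.trans c3
        · exact h4.trans c4
    _ = (1 / (θ - lam) + 1 / (1 - lam * θ)) * (θ ^ k * α + θ ^ (n - k) * β) := by ring

end Geometric

/-! ## The weighted-maximum argument (pure real inequalities) -/

section WeightedMax

open Finset

/-- **Closing the two-sided scalar inequality.**  If a non-negative finite sequence `a_0,…,a_n` satisfies
`a_k ≤ Nλ^k a_0 + Nλ^{n-k} a_n + Nc(Σ_{j<k} λ^{k-1-j} a_j + Σ_{k≤j<n} λ^{j+1-k} a_j)` for all `k ≤ n`, with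
`0 ≤ λ < θ < 1` and `cK ≤ 1/2`, `K = 1/(θ-λ) + 1/(1-λθ)`, then `a_k ≤ 2N(θ^k a_0 + θ^{n-k} a_n)`. [folklore] -/
theorem two_sided_bound_of_ineq {a : ℕ → ℝ} {n : ℕ} {N c lam θ : ℝ} (hN : 0 < N) (h0 : 0 ≤ lam)
    (hθ : lam < θ) (hθ1 : θ < 1) (ha : ∀ k, 0 ≤ a k) (hc : 0 ≤ c)
    (hcK : N * c * (1 / (θ - lam) + 1 / (1 - lam * θ)) ≤ 1 / 2)
    (hineq : ∀ k, k ≤ n → a k ≤ N * lam ^ k * a 0 + N * lam ^ (n - k) * a n +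
      N * c * (∑ j ∈ range k, lam ^ (k - 1 - j) * a j + ∑ j ∈ Ico k n, lam ^ (j + 1 - k) * a j)) :
    ∀ k, k ≤ n → a k ≤ 2 * N * (θ ^ k * a 0 + θ ^ (n - k) * a n) := by
  have hθ0 : 0 < θ := lt_of_le_of_lt h0 hθ
  set K : ℝ := 1 / (θ - lam) + 1 / (1 - lam * θ) with hK
  intro i hi
  -- it suffices to prove the bound with `a 0, a n` replaced by `a 0 + ζ, a n + ζ`, `ζ > 0`
  refine le_of_forall_pos_le_add fun ε hε => ?_
  set ζ : ℝ := ε / (4 * N) with hζ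
  have hζpos : 0 < ζ := by positivity
  set α : ℝ := a 0 + ζ with hα
  set β : ℝ := a n + ζ with hβ
  have hαpos : 0 < α := by have := ha 0; linarith
  have hβpos : 0 < β := by have := ha n; linarith
  set b : ℕ → ℝ := fun k => θ ^ k * α + θ ^ (n - k) * β with hb
  have hbpos : ∀ k, 0 < b k := fun k => by
    have h1 : 0 < θ ^ k * α := mul_pos (pow_pos hθ0 k) hαpos
    have h2 : 0 < θ ^ (n - k) * β := mul_pos (pow_pos hθ0 _) hβpos
    simp only [hb]; linarith
  -- the maximiser of `a k / b k` over `k ≤ n`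
  obtain ⟨ks, hks, hmax⟩ := Finset.exists_max_image (range (n + 1)) (fun k => a k / b k)
    ⟨0, Finset.mem_range.2 (Nat.succ_pos n)⟩
  set M : ℝ := a ks / b ks with hM
  have hM0 : 0 ≤ M := div_nonneg (ha ks) (hbpos ks).le
  have haM : ∀ k, k ≤ n → a k ≤ M * b k := fun k hk => by
    have := hmax k (Finset.mem_range.2 (Nat.lt_succ_of_le hk))
    rwa [div_le_iff₀ (hbpos k)] at this
  have hksn : ks ≤ n := Nat.le_of_lt_succ (Finset.mem_range.1 hks)
  -- the inequality at the maximiser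
  have hsum : ∑ j ∈ range ks, lam ^ (ks - 1 - j) * a j + ∑ j ∈ Ico ks n, lam ^ (j + 1 - ks) * a j ≤
      M * (K * b ks) := by
    have hw := weighted_sums_le h0 hθ hθ1 hαpos.le hβpos.le hksn
    have t1 : ∑ j ∈ range ks, lam ^ (ks - 1 - j) * a j ≤ ∑ j ∈ range ks, lam ^ (ks - 1 - j) * (M * b j) := by
      refine Finset.sum_le_sum fun j hj => ?_
      have hjn : j ≤ n := by have := Finset.mem_range.1 hj; omega
      exact mul_le_mul_of_nonneg_left (haM j hjn) (pow_nonneg h0 _)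
    have t2 : ∑ j ∈ Ico ks n, lam ^ (j + 1 - ks) * a j ≤ ∑ j ∈ Ico ks n, lam ^ (j + 1 - ks) * (M * b j) := by
      refine Finset.sum_le_sum fun j hj => ?_
      have hjn : j ≤ n := (Finset.mem_Ico.1 hj).2.le
      exact mul_le_mul_of_nonneg_left (haM j hjn) (pow_nonneg h0 _)
    have e1 : ∑ j ∈ range ks, lam ^ (ks - 1 - j) * (M * b j) = M * ∑ j ∈ range ks, lam ^ (ks - 1 - j) * b j := by
      rw [Finset.mul_sum]; refine Finset.sum_congr rfl fun j _ => ?_; ring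
    have e2 : ∑ j ∈ Ico ks n, lam ^ (j + 1 - ks) * (M * b j) = M * ∑ j ∈ Ico ks n, lam ^ (j + 1 - ks) * b j := by
      rw [Finset.mul_sum]; refine Finset.sum_congr rfl fun j _ => ?_; ring
    calc ∑ j ∈ range ks, lam ^ (ks - 1 - j) * a j + ∑ j ∈ Ico ks n, lam ^ (j + 1 - ks) * a j
        ≤ M * ∑ j ∈ range ks, lam ^ (ks - 1 - j) * b j + M * ∑ j ∈ Ico ks n, lam ^ (j + 1 - ks) * b j := by
          rw [← e1, ← e2]; exact add_le_add t1 t2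
      _ = M * (∑ j ∈ range ks, lam ^ (ks - 1 - j) * b j + ∑ j ∈ Ico ks n, lam ^ (j + 1 - ks) * b j) := by ring
      _ ≤ M * (K * b ks) := mul_le_mul_of_nonneg_left hw hM0
  have hlamθ : ∀ k, lam ^ k ≤ θ ^ k := fun k => pow_le_pow_left₀ h0 hθ.le k
  have hfirst : N * lam ^ ks * a 0 + N * lam ^ (n - ks) * a n ≤ N * b ks := by
    have h1 : lam ^ ks * a 0 ≤ θ ^ ks * α :=
      mul_le_mul (hlamθ ks) (by linarith) (ha 0) (pow_nonneg hθ0.le _)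
    have h2 : lam ^ (n - ks) * a n ≤ θ ^ (n - ks) * β :=
      mul_le_mul (hlamθ _) (by linarith) (ha n) (pow_nonneg hθ0.le _)
    simp only [hb]; nlinarith
  have hMle : M ≤ 2 * N := by
    have key : M * b ks ≤ N * b ks + N * c * (M * (K * b ks)) := by
      have := hineq ks hksn
      rw [hM, div_mul_cancel₀ _ (hbpos ks).ne']
      calc a ks ≤ N * lam ^ ks * a 0 + N * lam ^ (n - ks) * a n +
            N * c * (∑ j ∈ range ks, lam ^ (ks - 1 - j) * a j + ∑ j ∈ Ico ks n, lam ^ (j + 1 - ks) * a j) := this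
        _ ≤ N * b ks + N * c * (M * (K * b ks)) := by
            gcongr
    -- divide by `b ks > 0` and use `N c K ≤ 1/2`
    have key' : M ≤ N + N * c * K * M := by
      have hb0 := hbpos ks
      have : M * b ks ≤ (N + N * c * K * M) * b ks := by nlinarith
      exact le_of_mul_le_mul_right this hb0
    have : N * c * K * M ≤ M / 2 := by
      have := mul_le_mul_of_nonneg_right hcK hM0
      linarith
    linarith
  -- conclude
  have hθk1 : θ ^ i ≤ 1 := pow_le_one₀ hθ0.le hθ1.le
  have hθnk1 : θ ^ (n - i) ≤ 1 := pow_le_one₀ hθ0.le hθ1.le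
  calc a i ≤ M * b i := haM i hi
    _ ≤ 2 * N * b i := mul_le_mul_of_nonneg_right hMle (hbpos i).le
    _ = 2 * N * (θ ^ i * a 0 + θ ^ (n - i) * a n) + 2 * N * (θ ^ i + θ ^ (n - i)) * ζ := by
        simp only [hb, hα, hβ]; ring
    _ ≤ 2 * N * (θ ^ i * a 0 + θ ^ (n - i) * a n) + 2 * N * 2 * ζ := by
        gcongr
        linarith
    _ = 2 * N * (θ ^ i * a 0 + θ ^ (n - i) * a n) + ε := by
        simp only [hζ]; field_simp; ring

end WeightedMax

end Literature.Dynamics.Hyperbolic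

end
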